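import Literature.AlgebraicGeometry.Frobenioids.Thm42DilatingModel
import Literature.AlgebraicGeometry.Frobenioids.Thm42Sub
import Literature.AlgebraicGeometry.Frobenioids.PreFrobenioidEquivalence
import Literature.AlgebraicGeometry.Frobenioids.PrimaryStepsTransport
import HarnessLib

/-!
# [FrdI] Theorem 4.2 (i), row T42-L02 as typed (`FrdI.T42.PreservesDivFrobTrivial`): a DILATING model
# Frobenioid — part 2, the twisted self-equivalence and the refutation (FACT-LIST row F-2398)

Mochizuki, *The geometry of Frobenioids I: the general theory*, Kyushu J. Math. **62** (2008)
293–400, §4, Theorem 4.2 (i), proof p. 78 ll. 36–38 ("by Proposition 1.14, (v) … `Ψ` preserves …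
Div-identity prime-Frobenius endomorphisms"); Prop. 1.14 (v) p. 41 (hypothesis: "`Φ` is non-dilating");
Def. 3.1 (i)(e) p. 56 [cite: MochizukiFrdI2008, Thm. 4.2 (i) p.78].

OURS (abc-iut cell, F wave seat f-050; NOT a construction of the paper) — sequel of `Thm42DilatingModel.lean`.
On the dilating model Frobenioid `C → F_Φ` over `BΓ` (objects `(∗,[a])`, `a ∈ ℝ`; arrows `(n, t, Z)` with
`n·a + Z = e^t·b`) the TWIST `Ψ` — objects `a ↦ a³`, arrows `(n, t, Z) ↦ (n, 3t − 2 log n, ((e^t b)³ − (n a)³)/n²)` —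
is a self-equivalence of `C` (`twist_full`, `twist_faithful`, `twist_essSurj`; `Ψe := twist.asEquivalence`)
which preserves and reflects pre-steps, steps, morphisms of Frobenius type, Frobenius degrees and pull-back
morphisms, so that EVERY field of `FrdI.T42.Setting F F Ψe` holds (`setting`: `C` is a Frobenioid of perfect and
isotropic type with `Φ ≡ ℝ_{≥0}` perf-factorial). Yet the Div-identity prime-Frobenius endomorphism
`α₀ = (2, 0, 0)` of the non-group-like object `(∗,[0])` is carried to `(2, −2 log 2, 0)`, whose projection pulls
`Φ(∗) = ℝ_{≥0}` back by the dilation `x ↦ x/4 ≠ id`: clause (a) of the slot fails, hence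
`FrdI.T42.not_preservesDivFrobTrivial : ¬ PreservesDivFrobTrivial.{0, 0, 0, 0, 0}`.

CLASSIFICATION (cell protocol): refuted-MISSTATED — the witness exploits exactly the missing side condition
"`Φ₂` non-dilating" (Def. 3.1 (i)(e), part of "standard type" in the hypotheses of Thm. 4.2); the repaired
statement `Setting F₁ F₂ Ψ → IsNonDilatingOn Φ₂ → (a) ∧ (b) ∧ (c)` is the tree's
`FrdI.T42.preservesDivFrobTrivial_of_nonDilating` (`Thm42Assembly.lean`), which this witness misses
(`not_isNonDilatingOn_Φ`). Consumers must bind the repaired form. Nothing of [FrdI] is contradicted: the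
paper's Thm. 4.2 carries non-dilation. Nothing here bears on [IUTchIII] Cor. 3.12.
-/

noncomputable section

namespace Literature.AlgebraicGeometry.Frobenioids

open CategoryTheory Opposite Function
open scoped NNReal

namespace FrdI.T42.DilatingWitness

/-! ### The twist of the projections: `ρ(t, n) = 3t − 2 log n` -/

/-- `ρ(t, n) := 3t − 2 log n ∈ Γ`. [cite: MochizukiFrdI2008, Thm. 4.2 (i) p.78] -/
def ρ (t : Γ) (n : ℕ+) : Γ := Multiplicative.ofAdd (3 * Multiplicative.toAdd t - 2 * Real.log n)

/-- `ρ(t, n)` in additive coordinates. [cite: MochizukiFrdI2008, Thm. 4.2 (i) p.78] -/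
@[simp] theorem toAdd_ρ (t : Γ) (n : ℕ+) :
    Multiplicative.toAdd (ρ t n) = 3 * Multiplicative.toAdd t - 2 * Real.log n := rfl

/-- `ρ(0, 1) = 0`. [cite: MochizukiFrdI2008, Thm. 4.2 (i) p.78] -/
theorem ρ_one_one : ρ 1 1 = 1 :=
  Multiplicative.toAdd.injective (by rw [toAdd_ρ, toAdd_one, PNat.one_coe, Nat.cast_one, Real.log_one]; ring)

/-- `ρ` is a homomorphism `Γ × ℕ_{≥1} → Γ`. [cite: MochizukiFrdI2008, Thm. 4.2 (i) p.78] -/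
theorem ρ_mul (s t : Γ) (m n : ℕ+) : ρ (s * t) (m * n) = ρ s m * ρ t n :=
  Multiplicative.toAdd.injective (by
    rw [toAdd_mul, toAdd_ρ, toAdd_ρ, toAdd_ρ, toAdd_mul, PNat.mul_coe, Nat.cast_mul,
      Real.log_mul (Nat.cast_ne_zero.2 m.pos.ne') (Nat.cast_ne_zero.2 n.pos.ne')]
    ring)

/-- `ρ(·, n)` is injective. [cite: MochizukiFrdI2008, Thm. 4.2 (i) p.78] -/
theorem ρ_injective (n : ℕ+) {s t : Γ} (h : ρ s n = ρ t n) : s = t := by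
  have h' := congrArg Multiplicative.toAdd h
  rw [toAdd_ρ, toAdd_ρ] at h'
  exact Multiplicative.toAdd.injective (by linarith)

/-- The preimage of `t'` under `ρ(·, n)`. [cite: MochizukiFrdI2008, Thm. 4.2 (i) p.78] -/
def ρinv (t' : Γ) (n : ℕ+) : Γ := Multiplicative.ofAdd ((Multiplicative.toAdd t' + 2 * Real.log n) / 3)

/-- `ρ (ρinv t' n) n = t'`. [cite: MochizukiFrdI2008, Thm. 4.2 (i) p.78] -/
theorem ρ_ρinv (t' : Γ) (n : ℕ+) : ρ (ρinv t' n) n = t' :=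
  Multiplicative.toAdd.injective (by rw [toAdd_ρ, ρinv, toAdd_ofAdd]; ring)

/-- The dilation factor of `ρ(t, n)`: `e^{ρ(t,n)} = (e^t)³ / n²`. [cite: MochizukiFrdI2008, Thm. 4.2 (i) p.78] -/
theorem coe_c_ρ (t : Γ) (n : ℕ+) : (c (ρ t n) : ℝ) = (c t : ℝ) ^ 3 / (n : ℝ) ^ 2 := by
  have hn : (0 : ℝ) < n := Nat.cast_pos.2 n.pos
  rw [coe_c, coe_c, toAdd_ρ, Real.exp_sub, show (3 : ℝ) * Multiplicative.toAdd t = ((3 : ℕ) : ℝ) *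
    Multiplicative.toAdd t by norm_num, Real.exp_nat_mul, show (2 : ℝ) * Real.log n = ((2 : ℕ) : ℝ) *
    Real.log n by norm_num, Real.exp_nat_mul, Real.exp_log hn]

/-! ### The twisted divisor of an arrow -/

/-- `3` is odd. [folklore] -/
private theorem odd_three : Odd 3 := ⟨1, rfl⟩

/-- The twisted divisor `((e^t b)³ − (n a)³)/n²` of an arrow `(n, t, Z) : (∗,[a]) → (∗,[b])`.
[cite: MochizukiFrdI2008, Thm. 4.2 (i) p.78] -/
def twistDiv {X Y : C} (φ : X ⟶ Y) : ℝ :=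
  ((c (ModelFrobenioid.baseMap φ) * crd Y) ^ 3 - ((ModelFrobenioid.degFr φ : ℝ) * crd X) ^ 3) /
    (ModelFrobenioid.degFr φ : ℝ) ^ 2

/-- `n a ≤ e^t b` for an arrow `(n, t, Z) : (∗,[a]) → (∗,[b])` (as `Z ≥ 0`). [cite: MochizukiFrdI2008, Thm. 5.2(i) p.100] -/
theorem degFr_mul_crd_le {X Y : C} (φ : X ⟶ Y) :
    (ModelFrobenioid.degFr φ : ℝ) * crd X ≤ c (ModelFrobenioid.baseMap φ) * crd Y := by
  have h := rel_crd φ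
  have hZ := v_nonneg (ModelFrobenioid.div φ)
  linarith

/-- The twisted divisor is non-negative. [cite: MochizukiFrdI2008, Thm. 4.2 (i) p.78] -/
theorem twistDiv_nonneg {X Y : C} (φ : X ⟶ Y) : 0 ≤ twistDiv φ :=
  div_nonneg (sub_nonneg.2 ((odd_three.pow_le_pow).2 (degFr_mul_crd_le φ))) (sq_nonneg _)

/-- The relation of the twisted arrow `(n, ρ(t,n), ((e^t b)³ − (n a)³)/n²) : (∗,[a³]) → (∗,[b³])`.
[cite: MochizukiFrdI2008, Thm. 4.2 (i) p.78] -/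
theorem twistDiv_rel {X Y : C} (φ : X ⟶ Y) :
    (ModelFrobenioid.degFr φ : ℝ) * crd (obj (crd X ^ 3)) + twistDiv φ =
      c (ρ (ModelFrobenioid.baseMap φ) (ModelFrobenioid.degFr φ)) * crd (obj (crd Y ^ 3)) := by
  have hn : (ModelFrobenioid.degFr φ : ℝ) ≠ 0 := Nat.cast_ne_zero.2 (ModelFrobenioid.degFr φ).pos.ne'
  rw [crd_obj, crd_obj, coe_c_ρ, twistDiv]
  field_simp
  ring

/-- The twisted divisor vanishes iff the divisor does. [cite: MochizukiFrdI2008, Thm. 4.2 (i) p.78] -/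
theorem twistDiv_eq_zero_iff {X Y : C} (φ : X ⟶ Y) : twistDiv φ = 0 ↔ ModelFrobenioid.div φ = 1 := by
  have hn : (ModelFrobenioid.degFr φ : ℝ) ≠ 0 := Nat.cast_ne_zero.2 (ModelFrobenioid.degFr φ).pos.ne'
  rw [twistDiv, div_eq_zero_iff, or_iff_left (pow_ne_zero 2 hn), sub_eq_zero, odd_three.pow_injective.eq_iff,
    ← v_eq_zero_iff]
  have h := rel_crd φ
  constructor <;> intro h' <;> linarith

/-! ### The twist functor `Ψ : C ⥤ C` -/

/-- **The twist** `Ψ : C ⥤ C`: `(∗,[a]) ↦ (∗,[a³])`, `(n, t, Z) ↦ (n, 3t − 2 log n, ((e^t b)³ − (n a)³)/n²)`.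
[cite: MochizukiFrdI2008, Thm. 4.2 (i) p.78] -/
def twist : C ⥤ C where
  obj X := obj (crd X ^ 3)
  map φ := homOf _ _ (ModelFrobenioid.degFr φ) (ρ (ModelFrobenioid.baseMap φ) (ModelFrobenioid.degFr φ))
    (twistDiv φ) (twistDiv_nonneg φ) (twistDiv_rel φ)
  map_id X := hom_eq _ _ rfl (by
    rw [baseMap_homOf]
    exact (congrArg (fun n => ρ (1 : Γ) n) (ModelFrobenioid.degFr_id (X := X))).trans ρ_one_one)
  map_comp φ ψ := hom_eq _ _ rfl (by
    rw [baseMap_homOf, ModelFrobenioid.baseMap_comp, ModelFrobenioid.baseMap_comp, baseMap_homOf, baseMap_homOf,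
      ModelFrobenioid.degFr_comp]
    exact ρ_mul (show Γ from ModelFrobenioid.baseMap ψ) (show Γ from ModelFrobenioid.baseMap φ) _ _)

/-- `Ψ` on objects, in coordinates. [cite: MochizukiFrdI2008, Thm. 4.2 (i) p.78] -/
@[simp] theorem crd_twist_obj (X : C) : crd (twist.obj X) = crd X ^ 3 := crd_obj _

/-- `Ψ` preserves Frobenius degrees. [cite: MochizukiFrdI2008, Thm. 4.2 (i) p.78] -/
@[simp] theorem degFr_twist_map {X Y : C} (φ : X ⟶ Y) :
    ModelFrobenioid.degFr (twist.map φ) = ModelFrobenioid.degFr φ := rfl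

/-- The projection of `Ψ φ` is `ρ(t, n)`. [cite: MochizukiFrdI2008, Thm. 4.2 (i) p.78] -/
theorem baseMap_twist_map {X Y : C} (φ : X ⟶ Y) :
    (ModelFrobenioid.baseMap (twist.map φ) : Γ) = ρ (ModelFrobenioid.baseMap φ) (ModelFrobenioid.degFr φ) := rfl

/-- `Ψ` preserves and reflects isometries (`Div = 0`). [cite: MochizukiFrdI2008, Thm. 4.2 (i) p.78] -/
theorem div_twist_map_eq_one_iff {X Y : C} (φ : X ⟶ Y) :
    ModelFrobenioid.div (twist.map φ) = 1 ↔ ModelFrobenioid.div φ = 1 := by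
  rw [← v_eq_zero_iff, ← twistDiv_eq_zero_iff]
  exact Iff.rfl

/-- `Ψ` is full: `(n, t', Z') : Ψ X → Ψ Y` is the image of `(n, ρ⁻¹(t'), e^{ρ⁻¹(t')} b − n a)`.
[cite: MochizukiFrdI2008, Thm. 4.2 (i) p.78] -/
theorem twist_full : twist.Full where
  map_surjective {X Y} ψ := by
    let n := ModelFrobenioid.degFr ψ
    let t : Γ := ρinv (ModelFrobenioid.baseMap ψ) n
    have hn : (0 : ℝ) < n := Nat.cast_pos.2 n.pos
    have hρ : ρ t n = ModelFrobenioid.baseMap ψ := ρ_ρinv _ _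
    -- `e^t b ≥ n a` from the relation of `ψ : (∗,[a³]) → (∗,[b³])`
    have hle : (n : ℝ) * crd X ≤ c t * crd Y := by
      have h := degFr_mul_crd_le ψ
      rw [crd_twist_obj, crd_twist_obj, ← hρ, coe_c_ρ] at h
      have h3 : ((n : ℝ) * crd X) ^ 3 ≤ (c t * crd Y) ^ 3 := by
        have h' := mul_le_mul_of_nonneg_left h (sq_nonneg (n : ℝ))
        calc ((n : ℝ) * crd X) ^ 3 = (n : ℝ) ^ 2 * (n * crd X ^ 3) := by ring
          _ ≤ (n : ℝ) ^ 2 * ((c t : ℝ) ^ 3 / (n : ℝ) ^ 2 * crd Y ^ 3) := h'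
          _ = (c t * crd Y) ^ 3 := by field_simp
      exact (odd_three.pow_le_pow).1 h3
    refine ⟨homOf X Y n t _ (sub_nonneg.2 hle) (by rw [add_sub_cancel]), hom_eq _ _ rfl ?_⟩
    rw [baseMap_twist_map, baseMap_homOf, degFr_homOf]
    exact hρ

/-- `Ψ` is faithful (an arrow is determined by `(n, t)`, and `ρ(·, n)` is injective).
[cite: MochizukiFrdI2008, Thm. 4.2 (i) p.78] -/
theorem twist_faithful : twist.Faithful where
  map_injective {X Y} φ₁ φ₂ h := by
    have hd : ModelFrobenioid.degFr φ₁ = ModelFrobenioid.degFr φ₂ := by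
      rw [← degFr_twist_map φ₁, h, degFr_twist_map]
    refine hom_eq _ _ hd (ρ_injective (ModelFrobenioid.degFr φ₂) ?_)
    have hb := congrArg (fun χ => (ModelFrobenioid.baseMap χ : Γ)) h
    rw [baseMap_twist_map, baseMap_twist_map, hd] at hb
    exact hb

/-- An isomorphism `(1, t, 0) : X ⥲ Y` from `crd X = e^t · crd Y`. [cite: MochizukiFrdI2008, Thm. 5.2(ii) p.101] -/
theorem nonempty_iso_of_crd (X Y : C) (t : Γ) (h : crd X = c t * crd Y) : Nonempty (X ≅ Y) := by
  let f : X ⟶ Y := homOf X Y 1 t 0 le_rfl (by rw [PNat.one_coe, Nat.cast_one, one_mul, add_zero, h])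
  haveI : IsIso f := (isIso_iff f).2 ⟨rfl, (v_eq_zero_iff _).1 rfl⟩
  exact ⟨asIso f⟩

/-- `Ψ` is essentially surjective: the isomorphism classes of `C` are `{a = 0}`, `{a > 0}`, `{a < 0}`, hit by
`Ψ(∗,[0])`, `Ψ(∗,[1])`, `Ψ(∗,[−1])`. [cite: MochizukiFrdI2008, Thm. 4.2 (i) p.78] -/
theorem twist_essSurj : twist.EssSurj where
  mem_essImage Y := by
    rcases lt_trichotomy 0 (crd Y) with hb | hb | hb
    · refine ⟨obj 1, nonempty_iso_of_crd _ _ (Multiplicative.ofAdd (-Real.log (crd Y))) ?_⟩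
      rw [crd_twist_obj, crd_obj, one_pow, coe_c, toAdd_ofAdd, Real.exp_neg, Real.exp_log hb,
        inv_mul_cancel₀ hb.ne']
    · refine ⟨obj 0, nonempty_iso_of_crd _ _ 1 ?_⟩
      rw [crd_twist_obj, crd_obj, ← hb, mul_zero]
      norm_num
    · have hb' : 0 < -crd Y := neg_pos.2 hb
      refine ⟨obj (-1), nonempty_iso_of_crd _ _ (Multiplicative.ofAdd (-Real.log (-crd Y))) ?_⟩
      rw [crd_twist_obj, crd_obj, coe_c, toAdd_ofAdd, Real.exp_neg, Real.exp_log hb', inv_neg, neg_mul,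
        inv_mul_cancel₀ hb.ne]
      norm_num

/-- `Ψ` is an equivalence of categories. [cite: MochizukiFrdI2008, Thm. 4.2 (i) p.78] -/
theorem twist_isEquivalence : twist.IsEquivalence :=
  @Functor.IsEquivalence.mk _ _ _ _ twist twist_faithful twist_full twist_essSurj

/-- **`Ψ` as a self-equivalence `C ≌ C`.** [cite: MochizukiFrdI2008, Thm. 4.2 (i) p.78] -/
def Ψe : C ≌ C := @Functor.asEquivalence _ _ _ _ twist twist_isEquivalence

/-- The functor of `Ψe` is the twist. [cite: MochizukiFrdI2008, Thm. 4.2 (i) p.78] -/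
theorem Ψe_functor : Ψe.functor = twist := rfl

/-! ### The hypotheses `FrdI.T42.Setting F F Ψe` -/

/-- `Ψ Ψ⁻¹ φ = ε_X ≫ φ ≫ ε_Y⁻¹` with the counit isomorphisms. [cite: MochizukiFrdI2008, Thm. 3.4 (iii) p.62] -/
theorem twist_map_inverse_map {X Y : C} (φ : X ⟶ Y) :
    twist.map (Ψe.inverse.map φ) = (Ψe.counitIso.app X).hom ≫ φ ≫ (Ψe.counitIso.app Y).inv :=
  Ψe.fun_inv_map X Y φ

/-- `Ψ⁻¹` preserves Frobenius degrees. [cite: MochizukiFrdI2008, Thm. 3.4 (iii) p.62] -/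
theorem degFr_inverse_map {X Y : C} (φ : X ⟶ Y) :
    ModelFrobenioid.degFr (Ψe.inverse.map φ) = ModelFrobenioid.degFr φ := by
  have e2 : PreFrobenioid.degFr F ((Ψe.counitIso.app X).hom ≫ φ ≫ (Ψe.counitIso.app Y).inv) =
      PreFrobenioid.degFr F φ :=
    (PreFrobenioid.degFr_iso_comp (F := F) (Ψe.counitIso.app X).hom (φ ≫ (Ψe.counitIso.app Y).inv)).trans
      (PreFrobenioid.degFr_comp_iso (F := F) φ (Ψe.counitIso.app Y).inv)
  exact (congrArg (PreFrobenioid.degFr F) (twist_map_inverse_map φ)).trans e2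

/-- `Ψ⁻¹` preserves morphisms of Frobenius type. [cite: MochizukiFrdI2008, Thm. 3.4 (iii) p.62] -/
theorem isFrobeniusType_inverse_map {X Y : C} (φ : X ⟶ Y) (hφ : PreFrobenioid.IsFrobeniusType F φ) :
    PreFrobenioid.IsFrobeniusType F (Ψe.inverse.map φ) := by
  have h : PreFrobenioid.IsFrobeniusType F (twist.map (Ψe.inverse.map φ)) := by
    rw [twist_map_inverse_map]
    exact (hφ.comp_iso isFrobenioid.isPreFrobenioid (Ψe.counitIso.app Y).inv).iso_comp
      isFrobenioid.isPreFrobenioid (Ψe.counitIso.app X).hom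
  rw [isFrobeniusType_iff, div_twist_map_eq_one_iff] at h
  exact (isFrobeniusType_iff _).2 h

/-- `Ψ⁻¹` reflects isomorphisms onto steps: a step stays a step. [cite: MochizukiFrdI2008, Thm. 3.4 (ii) p.62] -/
theorem isStep_inverse_map {X Y : C} (φ : X ⟶ Y) (hφ : PreFrobenioid.IsStep F φ) :
    PreFrobenioid.IsStep F (Ψe.inverse.map φ) := by
  refine ⟨(isPreStep_iff _).2 ((degFr_inverse_map φ).trans ((isPreStep_iff _).1 hφ.1)), fun h => hφ.2 ?_⟩
  exact isIso_of_fully_faithful Ψe.inverse φ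

/-- **Every hypothesis of the proof of Thm. 4.2 recorded in `FrdI.T42.Setting` holds for `(F, F, Ψe)`.**
[cite: MochizukiFrdI2008, Thm. 4.2 p.78] -/
theorem setting : Setting F F Ψe where
  isFrobenioid₁ := isFrobenioid
  isFrobenioid₂ := isFrobenioid
  perfect₁ := isOfPerfectType
  perfect₂ := isOfPerfectType
  isotropic₁ := isOfIsotropicType
  isotropic₂ := isOfIsotropicType
  perfFactorial₁ := perfFactorial_Φ
  perfFactorial₂ := perfFactorial_Φ
  preStep_map _ _ φ h := (isPreStep_iff _).2 ((isPreStep_iff φ).1 h)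
  preStep_inv _ _ φ h := (isPreStep_iff _).2 ((degFr_inverse_map φ).trans ((isPreStep_iff φ).1 h))
  step_map _ _ φ h := ⟨(isPreStep_iff _).2 ((isPreStep_iff φ).1 h.1), fun h' => h.2
    (isIso_of_fully_faithful Ψe.functor φ)⟩
  step_inv _ _ φ h := isStep_inverse_map φ h
  frobeniusType_map _ _ φ h := (isFrobeniusType_iff _).2 ((div_twist_map_eq_one_iff φ).2
    ((isFrobeniusType_iff φ).1 h))
  frobeniusType_inv _ _ φ h := isFrobeniusType_inverse_map φ h
  degFr_map _ _ _ := rfl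
  pullback_map _ _ φ h := (isPullbackMorphism_iff _).2
    (by haveI := (isPullbackMorphism_iff φ).1 h; exact inferInstance)
  pullback_inv _ _ φ h := (isPullbackMorphism_iff _).2
    (by haveI := (isPullbackMorphism_iff φ).1 h; exact inferInstance)

/-! ### The refutation -/

/-- The non-group-like Div-Frobenius-trivial object `A₀ = (∗, [0])`. [cite: MochizukiFrdI2008, Thm. 4.2 (i) p.78] -/
def A₀ : C := obj 0

/-- `A₀` is not group-like (`Φ(∗) = ℝ_{≥0} ≠ 0`). [cite: MochizukiFrdI2008, Def. 1.2(iv) p.23] -/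
theorem not_isGroupLikeObj_A₀ : ¬ PreFrobenioid.IsGroupLikeObj F A₀ := fun h => by
  have h1 := congrArg v (h (ofReal 1 zero_le_one))
  rw [v_ofReal, v_one] at h1
  exact one_ne_zero h1

/-- The Div-identity prime-Frobenius endomorphism `α₀ = (2, 0, 0)` of `A₀`. [cite: MochizukiFrdI2008, Def. 1.2(iii) p.23] -/
def α₀ : A₀ ⟶ A₀ := homOf A₀ A₀ 2 1 0 le_rfl (by rw [A₀, crd_obj, mul_zero, mul_zero, add_zero])

/-- `α₀` is a Div-identity endomorphism. [cite: MochizukiFrdI2008, Def. 1.2(ii) p.22] -/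
theorem isDivIdentity_α₀ : PreFrobenioid.IsDivIdentity F α₀ :=
  (isDivIdentity_iff _).2 (by rw [α₀, baseMap_homOf, c_one, NNReal.coe_one])

/-- `α₀` is a prime-Frobenius morphism (Frobenius type, degree `2`). [cite: MochizukiFrdI2008, Def. 1.2(iii) p.23] -/
theorem isPrimeFrobenius_α₀ : PreFrobenioid.IsPrimeFrobenius F α₀ :=
  ⟨(isFrobeniusType_iff _).2 ((v_eq_zero_iff _).1 rfl), Nat.prime_two⟩

/-- **`Ψ α₀ = (2, −2 log 2, 0)` is NOT a Div-identity endomorphism**: its projection pulls `ℝ_{≥0}` back by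
`x ↦ x/4`. [cite: MochizukiFrdI2008, Thm. 4.2 (i) p.78] -/
theorem not_isDivIdentity_twist_α₀ : ¬ PreFrobenioid.IsDivIdentity F (twist.map α₀) := fun h => by
  have h1 := (isDivIdentity_iff _).1 h
  rw [baseMap_twist_map, coe_c_ρ, α₀, baseMap_homOf, degFr_homOf, c_one, NNReal.coe_one] at h1
  norm_num at h1

/-- **Row T42-L02 as typed is false**: `FrdI.T42.PreservesDivFrobTrivial` fails at universe level `0` — in the
dilating model, every field of `Setting F F Ψe` holds but clause (a) fails at `α₀`. REFUTED-MISSTATED: the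
repaired statement with `IsNonDilatingOn Φ₂` is `FrdI.T42.preservesDivFrobTrivial_of_nonDilating`, which this
witness misses (`not_isNonDilatingOn_Φ`). [cite: MochizukiFrdI2008, Thm. 4.2 (i) p.78] -/
theorem _root_.Literature.AlgebraicGeometry.Frobenioids.FrdI.T42.not_preservesDivFrobTrivial :
    ¬ PreservesDivFrobTrivial.{0, 0, 0, 0, 0} := fun h =>
  not_isDivIdentity_twist_α₀ ((h F F Ψe setting).1 A₀ not_isGroupLikeObj_A₀ α₀ isDivIdentity_α₀ isPrimeFrobenius_α₀)

end FrdI.T42.DilatingWitness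

end Literature.AlgebraicGeometry.Frobenioids
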